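import Mathlib
import HarnessLib

/-!
# Item `LrcModEntire` (stmt-NavierStokesRegularity-20428) — (Q4) entrance input: UNIQUENESS OF THE CROSS-SECTION MAXIMISER from strict concavity of the core and cold outer values

ns-k2-port-2 g5 (helper prover under the LEAD of item 20428, ns-poloidal-K2-p3 g14; `--supports stmt-NavierStokesRegularity-20428 --as helper`).
The `huniq` input of Danskin's theorem `…LrcModEntireRidgeDanskin.hasFDerivAt_sSup_of_unique_argmax` for a cross-section `g(n) = σU₂(−1+τ, Γ s + nν_Γ s + z e₂)` on `[−r, r]`:
transversal non-degeneracy gives `g″ < 0` on a core `[−r′, r′]` (Mathlib `strictConcaveOn_of_deriv2_neg`), and the values outside the core stay strictly below the centre value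
(thin tube + (U-LL)-type gap); then the maximiser over `[−r, r]` exists, lies in the open core, and is UNIQUE.  Class-free, one real variable:

* `eq_of_isMaxOn_of_strictConcaveOn` — two maximisers of `g` on `[−r,r]` that both lie in a set where `g` is strictly concave coincide;
* `exists_unique_argmax` — `g` continuous on `[−r,r]`, strictly concave on `[−r′,r′]` (`0 < r′ ≤ r`), and `g n < g 0` for `r′ ≤ |n| ≤ r` ⇒
  `∃ n₀ ∈ Ioo (−r′) r′`, a maximiser on `[−r,r]`, with `g n < g n₀` for every other `n ∈ [−r,r]`.

WHAT THIS IS NOT: not a claim about Navier–Stokes regularity — a calculus lemma for the entrance of the research cell (Q4) on hypothetical profiles (bears_on LADDER-NS N0, item 20428 /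
crux 19708; 20428/19708/27893 OPEN).  No summit statement is proved here.
-/

noncomputable section

-- the summit and its single sub-problem share the name (CONVENTIONS §1), as in every Theorems file
set_option linter.dupNamespace false

namespace Summit.NavierStokesRegularity.NavierStokesRegularity.Theorems.PoloidalWindowDoorLrcModEntireRidgeArgmax

open Set

/-- **Two maximisers inside a region of strict concavity coincide.** [folklore] -/
theorem eq_of_isMaxOn_of_strictConcaveOn {g : ℝ → ℝ} {K C : Set ℝ} (hconc : StrictConcaveOn ℝ C g) (hCK : C ⊆ K)
    {n₁ n₂ : ℝ} (h₁ : n₁ ∈ C) (h₂ : n₂ ∈ C) (hmax₁ : IsMaxOn g K n₁) (hmax₂ : IsMaxOn g K n₂) : n₁ = n₂ := by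
  by_contra hne
  -- the midpoint beats the smaller of the two equal maxima
  have hmid : (n₁ + n₂) / 2 ∈ openSegment ℝ n₁ n₂ := by
    rw [openSegment_eq_image]
    refine ⟨1 / 2, ⟨by norm_num, by norm_num⟩, ?_⟩
    simp only [smul_eq_mul]; ring
  have hlt := hconc.lt_on_openSegment h₁ h₂ hne hmid
  have hmemC : (n₁ + n₂) / 2 ∈ C := by
    have h := hconc.1 h₁ h₂ (by norm_num : (0 : ℝ) ≤ 1 / 2) (by norm_num : (0 : ℝ) ≤ 1 / 2) (by norm_num)
    have e : (1 / 2 : ℝ) • n₁ + (1 / 2 : ℝ) • n₂ = (n₁ + n₂) / 2 := by simp only [smul_eq_mul]; ring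
    rw [e] at h
    exact h
  have hle₁ : g ((n₁ + n₂) / 2) ≤ g n₁ := hmax₁ (hCK hmemC)
  have hle₂ : g ((n₁ + n₂) / 2) ≤ g n₂ := hmax₂ (hCK hmemC)
  have : min (g n₁) (g n₂) < min (g n₁) (g n₂) := lt_of_lt_of_le hlt (le_min hle₁ hle₂)
  exact lt_irrefl _ this

/-- **Existence and uniqueness of the cross-section maximiser.**  `g` continuous on `[−r, r]`, strictly concave on the core `[−r′, r′]` (`0 < r′ ≤ r`), and strictly below its centre
value outside the open core (`g n < g 0` for `r′ ≤ |n|`, `n ∈ [−r,r]`) ⇒ there is `n₀ ∈ (−r′, r′)` maximising `g` on `[−r, r]`, and every other point of `[−r, r]` has a strictly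
smaller value (the `hn₀`/`huniq` inputs of `…RidgeDanskin.hasFDerivAt_sSup_of_unique_argmax`). [folklore] -/
theorem exists_unique_argmax {g : ℝ → ℝ} {r r' : ℝ} (hr' : 0 < r') (hrr : r' ≤ r) (hg : ContinuousOn g (Icc (-r) r))
    (hconc : StrictConcaveOn ℝ (Icc (-r') r') g) (hout : ∀ n ∈ Icc (-r) r, r' ≤ |n| → g n < g 0) :
    ∃ n₀ ∈ Ioo (-r') r', IsMaxOn g (Icc (-r) r) n₀ ∧ ∀ n ∈ Icc (-r) r, n ≠ n₀ → g n < g n₀ := by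
  have hK : IsCompact (Icc (-r) r) := isCompact_Icc
  have h0K : (0 : ℝ) ∈ Icc (-r) r := ⟨by linarith, by linarith⟩
  obtain ⟨n₀, hn₀K, hmax⟩ := hK.exists_isMaxOn ⟨0, h0K⟩ hg
  -- the maximiser lies in the open core
  have hcore : ∀ n ∈ Icc (-r) r, IsMaxOn g (Icc (-r) r) n → n ∈ Ioo (-r') r' := by
    intro n hn hmaxn
    by_contra hnot
    have habs : r' ≤ |n| := by
      rw [mem_Ioo, not_and_or, not_lt, not_lt] at hnot
      rcases hnot with h | h
      · rw [abs_of_nonpos (by linarith)]; linarith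
      · rw [abs_of_nonneg (by linarith)]; exact h
    have h1 := hout n hn habs
    have h2 : g 0 ≤ g n := hmaxn h0K
    linarith
  have hn₀core := hcore n₀ hn₀K hmax
  refine ⟨n₀, hn₀core, hmax, fun n hn hne => ?_⟩
  -- any other point has a strictly smaller value: if equal it would be a second maximiser in the core
  have hle : g n ≤ g n₀ := hmax hn
  rcases lt_or_eq_of_le hle with hlt | heq
  · exact hlt
  · exfalso
    have hmaxn : IsMaxOn g (Icc (-r) r) n := fun m hm => by
      have h1 : g m ≤ g n₀ := hmax hm
      show g m ≤ g n
      linarith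
    have hncore := hcore n hn hmaxn
    have hCK : Icc (-r') r' ⊆ Icc (-r) r := Icc_subset_Icc (by linarith) hrr
    exact hne (eq_of_isMaxOn_of_strictConcaveOn hconc hCK (Ioo_subset_Icc_self hncore) (Ioo_subset_Icc_self hn₀core) hmaxn hmax)

end Summit.NavierStokesRegularity.NavierStokesRegularity.Theorems.PoloidalWindowDoorLrcModEntireRidgeArgmax

end
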